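import Literature.Geometry.Kaehler.ComplexTorusCoverQuotientCovering
import Literature.AlgebraicTopology.FundamentalGroup.EquivariantLiftSurjective
import HarnessLib

/-!
# A map into a complex torus covered by an equivariant map whose periods exhaust the lattice is onto on `π₁` and injective on `H¹`

Layer `Literature/Geometry/Kaehler`, namespace `Literature.Geometry.Kaehler.ComplexTorus`; sequel of
`ComplexTorusCoverQuotientCovering.lean` (`π = cover Φ : E → X = E/Φ(ℤ^ι)` is an additive quotient covering
for the lattice, `isAddQuotientCoveringMap_cover`) and of
`Literature/AlgebraicTopology/FundamentalGroup/EquivariantLiftSurjective.lean` (a map covered by an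
equivariant lift between quotient coverings is onto on `π₁` when the equivariance map is onto; mixed
multiplicative/additive form; `H¹`-injectivity).  THEOREMS ONLY, no definition, no named fact.

**The Albanese / period-map shape.** Let `p : B → Y` be a quotient covering for a group `G` acting on a
path-connected `B` (e.g. a compact ball quotient `𝔹ⁿ → Γ \ 𝔹ⁿ`), `A : B → E` continuous with
`A (g • z) = per g + A z` for a map `per : G → E` taking values in `Λ` (an additive subgroup with carrier
`Φ(ℤ^ι)`) and EXHAUSTING `Λ` (every lattice vector is a period), and `f : Y → X` continuous with
`f ∘ p = π ∘ A`.  Then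

* `surjective_fundamentalGroup_map_of_comp_cover` — `f_* : π₁(Y, p z₀) → π₁(X, f (p z₀))` is ONTO
  (`range_…_eq_top`, `index_…_eq_one`: the hypothesis shape of the tree's
  `singularHomology.map_one_surjective_of_index_ne_zero` and
  `Jacobian.injective_bettiCohomology_map_abelJacobi_of_index_ne_zero`); without the exhaustion hypothesis,
  for `per` a homomorphism, `index_range_fundamentalGroup_map_eq_of_comp_cover`:
  `[π₁(X) : f_* π₁(Y)] = [Λ : per(G)]`;
* `injective_singularCohomology_map_one_of_comp_cover` — **`f^* : H¹(X; F) → H¹(Y; F)` is injective** for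
  every field `F` of characteristic zero (Hatcher Thm. 2A.1 + Kronecker duality).

Use (cell `pub-hodgecm2`, plan ALB-H1-ISO steps S4/S7): with `B = 𝔹²`, `p = ballUnifMap`
(`UnitaryBallUniformisationDatum.isQuotientCoveringMap_ballUnifMap`), `A` the vector of primitives of a
basis of holomorphic `1`-forms, `per` the period homomorphism and `Λ` its image (a full lattice, presented
by `Φ` via `Literature.Algebra.Module.AddSubgroup.exists_continuousLinearEquiv_of_fg_of_finrank_le`), the
Albanese map `f` of the ball quotient is onto on `π₁` and injective on `H¹(·; ℚ)` ("`alb_*` maps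
`π₁(Y) ≅ Γ` onto the period lattice `Λ = π₁(Alb Y)`").

## References

* [HatcherAT2002] A. Hatcher, *Algebraic Topology* (2002), Prop. 1.39, Prop. 1.40, Thm. 2A.1.
* [LangeBirkenhake1992] H. Lange, Ch. Birkenhake, *Complex Abelian Varieties* (1992), Lemma 1.1.3 (a),
  §11.1 (the Albanese torus `H⁰(Ω¹)^*/H₁(X, ℤ)`).
-/

noncomputable section

open scoped Topology
open Set Function
open Literature.AlgebraicTopology.FundamentalGroup Literature.AlgebraicTopology.SingularHomology

universe u v

namespace Literature.Geometry.Kaehler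

namespace ComplexTorus

/-! ### Maps into the torus covered by an equivariant map: the Albanese / period-map shape -/

section Albanese

variable {ι : Type*} [Fintype ι] {E : Type*} [NormedAddCommGroup E] [NormedSpace ℂ E]
  (Φ : (ι → ℝ) ≃L[ℝ] E)
  {B Y : Type*} [TopologicalSpace B] [TopologicalSpace Y] {G : Type*} [Group G] [MulAction G B]
  {p : B → Y}

/-- **A map into a torus covered by a `per`-equivariant map whose periods exhaust the lattice is onto on
`π₁`.**  Setting: `p : B → Y` a quotient covering for `G` with `B` path connected; `A : B → E` continuous
with `A (g • z) = per g + A z`, `per g ∈ Λ` for all `g` and every `ℓ ∈ Λ` of the form `per g`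
(`Λ ≤ E` an additive subgroup with carrier `Φ(ℤ^ι)`); `f : Y → E/Φ(ℤ^ι)` continuous with `f (p z) = π (A z)`.
Then `f_* : π₁(Y, p z₀) → π₁(E/Φ(ℤ^ι), f (p z₀))` is surjective (`EquivariantLiftSurjective`, mixed form,
with `τ g = per g ∈ Λ` and the quotient covering `isAddQuotientCoveringMap_cover`; `E` is simply connected).
For the Albanese map of a compact quotient `Y = Γ \ B` of a simply connected domain this is "`alb_*` maps
`π₁(Y) ≅ Γ` onto the period lattice `Λ = π₁(Alb Y)`". [cite: HatcherAT2002, Prop. 1.39 and Prop. 1.40]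
[cite: LangeBirkenhake1992, Lemma 1.1.3] -/
theorem surjective_fundamentalGroup_map_of_comp_cover [PathConnectedSpace B]
    (hp : IsQuotientCoveringMap p G) (Λ : AddSubgroup E) (hΛ : (Λ : Set E) = Set.range (latticeVec Φ))
    (A : C(B, E)) (f : C(Y, ComplexTorus Φ)) (hf : ∀ z, f (p z) = cover Φ (A z))
    (per : G → E) (hper : ∀ (g : G) (z : B), A (g • z) = per g + A z) (hmem : ∀ g, per g ∈ Λ)
    (honto : ∀ ℓ ∈ Λ, ∃ g, per g = ℓ) (z₀ : B) :
    Surjective (FundamentalGroup.map f (p z₀)) := by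
  let τ : G → Λ := fun g ↦ ⟨per g, hmem g⟩
  have hτ : Surjective τ := fun ℓ ↦ by
    obtain ⟨g, hg⟩ := honto ℓ ℓ.2
    exact ⟨g, Subtype.ext hg⟩
  exact surjective_map_of_equivariant_vadd hp (isAddQuotientCoveringMap_cover Φ Λ hΛ) A f τ hτ
    (fun z ↦ (hf z).symm) (fun g z ↦ by rw [hper]; rfl) z₀

/-- Range form of `surjective_fundamentalGroup_map_of_comp_cover`: `f_* π₁(Y, p z₀) = ⊤`.
[cite: HatcherAT2002, Prop. 1.39 and Prop. 1.40] -/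
theorem range_fundamentalGroup_map_eq_top_of_comp_cover [PathConnectedSpace B]
    (hp : IsQuotientCoveringMap p G) (Λ : AddSubgroup E) (hΛ : (Λ : Set E) = Set.range (latticeVec Φ))
    (A : C(B, E)) (f : C(Y, ComplexTorus Φ)) (hf : ∀ z, f (p z) = cover Φ (A z))
    (per : G → E) (hper : ∀ (g : G) (z : B), A (g • z) = per g + A z) (hmem : ∀ g, per g ∈ Λ)
    (honto : ∀ ℓ ∈ Λ, ∃ g, per g = ℓ) (z₀ : B) :
    (FundamentalGroup.map f (p z₀)).range = ⊤ :=
  MonoidHom.range_eq_top.2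
    (surjective_fundamentalGroup_map_of_comp_cover Φ hp Λ hΛ A f hf per hper hmem honto z₀)

/-- Index form of `surjective_fundamentalGroup_map_of_comp_cover`:
`[π₁(E/Φ(ℤ^ι), f (p z₀)) : f_* π₁(Y, p z₀)] = 1` (the hypothesis shape of the tree's
`singularHomology.map_one_surjective_of_index_ne_zero` / `Jacobian.injective_bettiCohomology_map_abelJacobi_of_index_ne_zero`).
[cite: HatcherAT2002, Prop. 1.39 and Prop. 1.40] -/
theorem index_range_fundamentalGroup_map_eq_one_of_comp_cover [PathConnectedSpace B]
    (hp : IsQuotientCoveringMap p G) (Λ : AddSubgroup E) (hΛ : (Λ : Set E) = Set.range (latticeVec Φ))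
    (A : C(B, E)) (f : C(Y, ComplexTorus Φ)) (hf : ∀ z, f (p z) = cover Φ (A z))
    (per : G → E) (hper : ∀ (g : G) (z : B), A (g • z) = per g + A z) (hmem : ∀ g, per g ∈ Λ)
    (honto : ∀ ℓ ∈ Λ, ∃ g, per g = ℓ) (z₀ : B) :
    (FundamentalGroup.map f (p z₀)).range.index = 1 := by
  rw [range_fundamentalGroup_map_eq_top_of_comp_cover Φ hp Λ hΛ A f hf per hper hmem honto z₀,
    Subgroup.index_top]

/-- **Without the exhaustion hypothesis**: if `per` is a homomorphism into `Λ` (not necessarily onto), the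
index of `f_* π₁(Y)` in `π₁` of the torus is the index of the period group `per(G)` in the lattice `Λ`
(finite iff the periods span a sublattice of finite index). [cite: HatcherAT2002, Prop. 1.39 and Prop. 1.40] -/
theorem index_range_fundamentalGroup_map_eq_of_comp_cover [PathConnectedSpace B]
    (hp : IsQuotientCoveringMap p G) (Λ : AddSubgroup E) (hΛ : (Λ : Set E) = Set.range (latticeVec Φ))
    (A : C(B, E)) (f : C(Y, ComplexTorus Φ)) (hf : ∀ z, f (p z) = cover Φ (A z))
    (per : G →* Multiplicative Λ) (hper : ∀ (g : G) (z : B), A (g • z) = ((per g).toAdd : E) + A z)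
    (z₀ : B) :
    (FundamentalGroup.map f (p z₀)).range.index = per.range.index :=
  index_range_map_eq_of_equivariant hp (isAddQuotientCoveringMap_cover Φ Λ hΛ).toMultiplicative A f per
    (fun z ↦ (hf z).symm) (fun g z ↦ by rw [hper]; rfl) z₀

end Albanese

/-! ### Consequence on `H¹` -/

section Cohomology

variable {ι : Type u} [Fintype ι] {E : Type*} [NormedAddCommGroup E] [NormedSpace ℂ E]
  (Φ : (ι → ℝ) ≃L[ℝ] E)
  {B : Type*} {Y : Type u} [TopologicalSpace B] [TopologicalSpace Y] {G : Type*} [Group G]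
  [MulAction G B] {p : B → Y}

/-- **`f^* : H¹(E/Φ(ℤ^ι); F) → H¹(Y; F)` is injective** for a map `f` into the torus covered by a
`per`-equivariant continuous `A : B → E` whose periods exhaust the lattice (setting of
`surjective_fundamentalGroup_map_of_comp_cover`), `F` a field of characteristic zero: `f_*` is onto on
`π₁`, hence on `H₁(·; F)`, and `f^*` on `H¹` is its transpose.  For the Albanese map of a compact ball
quotient: `alb^*` is injective on `H¹(Alb; ℚ)`. [cite: HatcherAT2002, Thm. 2A.1] -/
theorem injective_singularCohomology_map_one_of_comp_cover [PathConnectedSpace B]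
    (F : Type v) [Field F] [CharZero F]
    (hp : IsQuotientCoveringMap p G) (Λ : AddSubgroup E) (hΛ : (Λ : Set E) = Set.range (latticeVec Φ))
    (A : C(B, E)) (f : C(Y, ComplexTorus Φ)) (hf : ∀ z, f (p z) = cover Φ (A z))
    (per : G → E) (hper : ∀ (g : G) (z : B), A (g • z) = per g + A z) (hmem : ∀ g, per g ∈ Λ)
    (honto : ∀ ℓ ∈ Λ, ∃ g, per g = ℓ) (z₀ : B) :
    Injective (singularCohomology.map F F f 1) := by
  let τ : G → Λ := fun g ↦ ⟨per g, hmem g⟩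
  have hτ : Surjective τ := fun ℓ ↦ by
    obtain ⟨g, hg⟩ := honto ℓ ℓ.2
    exact ⟨g, Subtype.ext hg⟩
  exact injective_singularCohomology_map_one_of_equivariant_vadd F hp
    (isAddQuotientCoveringMap_cover Φ Λ hΛ) A f τ hτ (fun z ↦ (hf z).symm)
    (fun g z ↦ by rw [hper]; rfl) z₀

end Cohomology

end ComplexTorus

end Literature.Geometry.Kaehler

end
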